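import Mathlib
import Summits.KontsevichZagierPeriods.Zeta5Search.WedgeDictionary
import HarnessLib

/-!
# ζ(5) search — the partial-fraction coefficients of `R_b` as Taylor coefficients at the poles (integer numerators)

Cell `pub-zeta5` (HONEST FRAMING: systematic search; no irrationality claim unless certified), typer seat
generation 7.  This is the `ℚ`/`ℤ` half of the Lean proof of the BIG-PRIME DIVISIBILITY THEOREM (W∞)/(U∞) for the
canonical coefficients of Brown–Zudilin's dual very-well-poised series `F̃₇(b) = U(b)ζ(5) + W(b)ζ(3) − V(b)`
(`WedgeDictionary.coeffU/coeffW`; theorem found and proved on paper by the cell's gen-2 seat, REPORT-gen2-g5 §5f;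
the `𝔽_p` half and the theorems are in `Zeta5Search/BigPrimeDivisibility.lean`).  Nothing here is a cited fact and
nothing concerns irrationality: these are identities of rational numbers and integer polynomials.

In the coordinate `y = t + 1` the summand of (34) is `R_b = numPoly_b(y) / ∏_{s=0}^{n} (y+s)^6` (`n = b₀`,
`DualSeries.term_eq`), with poles at `y = −s`; `WedgeDictionary.IsPFData b c` says that `c_{o,q}` is the coefficient of
`(y+q)^{−(o+1)}`.  Contents:

* `truncInv E N` — the truncated inverse numerator `Σ_{i<N} (e₀ − E)^i e₀^{N−1−i}`, `E · truncInv E N ≡ e₀^N (mod X^N)`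
  (`truncInv_spec`), for a polynomial `E` with constant coefficient `e₀` over any commutative ring; compatible with
  ring maps (`truncInv_map`); `map_taylor`, `taylor_prod'`, `taylor_X_add_C`.
* THE INTEGER MODEL: `block n β = [β, n−β]` (the pole indices carried by the lower parameter `β`), the block form of
  the numerator `numR R n β = (2X + n) ∏_{j<7} ∏_{s ∈ [0,n]∖block_j} (X + s)` over any ring (`numPoly_eq_numR`: over `ℚ`
  it IS `numPoly b`, via `pochPoly_pair_eq_prod_compl`), the recentred pole factors `ER R n q₀ = ∏_{s≠q₀}(X + s − q₀)^6`,
  `e0Z n q₀ = ∏_{s≠q₀} (s−q₀)^6 = E_{q₀}(0)` (`≠ 0`; no prime `p > n` divides it, `not_dvd_e0Z`), and the integers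
  `zZ n β q₀ i = [X^i] (numR(X − q₀) · truncInv E_{q₀} 6)`.
* THE IDENTITY (`pf_coeff_eq`): for partial-fraction data `c` of `R_b` (`b` in the box, `2b_j ≤ b₀+1`),
  `e₀(q₀)^6 · c_{o,q₀} = zZ n β q₀ (5−o)` for every pole `q₀ ≤ n` and order `o < 6` — the partial-fraction
  coefficients are Taylor coefficients of `numPoly(X − q₀)/E_{q₀}` and have the explicit integer numerators `z`.
  Route: `IsPFData` ⇒ the cleared polynomial identity `Lpoly = numPoly` (`Lpoly_eq_numPoly`, agreement at every
  `y = m+1` and `Polynomial.eq_of_infinite_eval_eq`) ⇒ `X^6 ∣ numPoly(X−q₀) − (Σ_o c_{o,q₀} X^{5−o})·E_{q₀}`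
  (`taylor_numPoly_congr`) ⇒ multiply by `truncInv`.
-/

noncomputable section

open Finset Polynomial

namespace Summit.KontsevichZagierPeriods.Zeta5Search.BigPrime

open Summit.KontsevichZagierPeriods.Zeta5Search.DualSeries (InBox numPoly)
open Summit.KontsevichZagierPeriods.Zeta5Search.WedgeDictionary (IsPFData)
open Literature.NumberTheory.Transcendental.BallRivoal (pochPoly pfEval poch)

/-! ### Generic polynomial algebra: truncated inverses modulo `X^N` -/

section Generic

variable {R : Type*} [CommRing R]

/-- Truncated-inverse numerator of `E` to order `N`: with `e₀ = E(0)`,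
`truncInv E N = Σ_{i<N} (e₀ − E)^i · e₀^{N−1−i}`, so that `E · truncInv E N ≡ e₀^N (mod X^N)`. -/
def truncInv (E : R[X]) (N : ℕ) : R[X] :=
  ∑ i ∈ range N, (C (E.coeff 0) - E) ^ i * C (E.coeff 0) ^ (N - 1 - i)

/-- `E · truncInv E N ≡ e₀^N (mod X^N)`. -/
theorem truncInv_spec (E : R[X]) (N : ℕ) : X ^ N ∣ E * truncInv E N - C (E.coeff 0 ^ N) := by
  have hgeom := geom_sum₂_mul (C (E.coeff 0) - E) (C (E.coeff 0)) N
  have hX : (X : R[X]) ∣ C (E.coeff 0) - E := by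
    rw [X_dvd_iff]; simp
  have hXN : X ^ N ∣ (C (E.coeff 0) - E) ^ N := pow_dvd_pow_of_dvd hX N
  have key : E * truncInv E N - C (E.coeff 0 ^ N) = -((C (E.coeff 0) - E) ^ N) := by
    rw [truncInv, C_pow]
    linear_combination (-1 : R[X]) * hgeom
  rw [key]
  exact hXN.neg_right

/-- `truncInv` commutes with ring maps. -/
theorem truncInv_map {S : Type*} [CommRing S] (φ : R →+* S) (E : R[X]) (N : ℕ) :
    (truncInv E N).map φ = truncInv (E.map φ) N := by
  simp only [truncInv, Polynomial.map_sum, Polynomial.map_mul, Polynomial.map_pow, Polynomial.map_sub,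
    map_C, coeff_map]

/-- Coefficients below `N` agree for polynomials congruent modulo `X^N`. -/
theorem coeff_eq_of_X_pow_dvd_sub {f g : R[X]} {N : ℕ} (h : X ^ N ∣ f - g) {i : ℕ} (hi : i < N) :
    f.coeff i = g.coeff i := by
  have := (X_pow_dvd_iff.1 h) i hi
  rwa [coeff_sub, sub_eq_zero] at this

/-- `taylor` through finite products. -/
theorem taylor_prod' {ι : Type*} (s : Finset ι) (f : ι → R[X]) (r : R) :
    taylor r (∏ i ∈ s, f i) = ∏ i ∈ s, taylor r (f i) :=
  map_prod (taylorAlgHom r) f s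

/-- `taylor` commutes with ring maps. -/
theorem map_taylor {S : Type*} [CommRing S] (φ : R →+* S) (f : R[X]) (r : R) :
    (taylor r f).map φ = taylor (φ r) (f.map φ) := by
  rw [taylor_apply, taylor_apply, map_comp]
  simp

/-- `taylor r (X + C a) = X + C (a + r)`. -/
theorem taylor_X_add_C (r a : R) : taylor r (X + C a) = X + C (a + r) := by
  rw [map_add, taylor_X, taylor_C, C_add]; ring

end Generic

/-! ### The integer-polynomial model of the numerator and of the pole data -/

/-- The block of pole indices attached to a lower parameter `β` (in `y = t+1` coordinates the poles of `R_b` are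
`y = −s`, `s = 0,…,n`): `block n β = [β, n − β]`. -/
def block (n β : ℕ) : Finset ℕ := Icc β (n - β)

section Model

variable (R : Type*) [CommRing R]

/-- The numerator `numPoly b` in BLOCK form over any commutative ring (through ℕ-casts):
`(2X + n) · ∏_{j<7} ∏_{s ∈ [0,n] ∖ block_j} (X + s)`. -/
def numR (n : ℕ) (β : ℕ → ℕ) : R[X] :=
  (C 2 * X + C (n : R)) * ∏ j ∈ range 7, ∏ s ∈ range (n + 1) \ block n (β j), (X + C (s : R))

/-- The sixth power of the product of the OTHER pole factors, recentred at the pole `q₀`: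
`E_{q₀} = ∏_{s ≤ n, s ≠ q₀} (X + (s − q₀))^6`. -/
def ER (n q₀ : ℕ) : R[X] := ∏ s ∈ (range (n + 1)).erase q₀, (X + C ((s : R) - q₀)) ^ 6

end Model

/-- The constant coefficient `e₀(q₀) = ∏_{s ≤ n, s ≠ q₀} (s − q₀)^6 ∈ ℤ` of `E_{q₀}`. -/
def e0Z (n q₀ : ℕ) : ℤ := ∏ s ∈ (range (n + 1)).erase q₀, ((s : ℤ) - q₀) ^ 6

/-- The INTEGER `z_{q₀,i}`: the `i`-th coefficient of `numR(X − q₀) · truncInv E_{q₀} 6` over `ℤ`. -/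
def zZ (n : ℕ) (β : ℕ → ℕ) (q₀ i : ℕ) : ℤ :=
  (taylor (-(q₀ : ℤ)) (numR ℤ n β) * truncInv (ER ℤ n q₀) 6).coeff i

/-- The block-form numerator is compatible with ring maps (it is defined through ℕ-casts). -/
theorem numR_map {R S : Type*} [CommRing R] [CommRing S] (φ : R →+* S) (n : ℕ) (β : ℕ → ℕ) :
    (numR R n β).map φ = numR S n β := by
  simp only [numR, Polynomial.map_mul, Polynomial.map_add, Polynomial.map_prod, map_C, map_X]
  simp only [map_natCast, map_ofNat]

/-- `E_{q₀}` is compatible with ring maps. -/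
theorem ER_map {R S : Type*} [CommRing R] [CommRing S] (φ : R →+* S) (n q₀ : ℕ) :
    (ER R n q₀).map φ = ER S n q₀ := by
  simp only [ER, Polynomial.map_prod, Polynomial.map_pow, Polynomial.map_add, map_C, map_X]
  simp only [map_sub, map_natCast]

/-- The constant coefficient of `E_{q₀}` over `ℤ` is `e₀(q₀)`. -/
theorem ER_coeff_zero (n q₀ : ℕ) : (ER ℤ n q₀).coeff 0 = e0Z n q₀ := by
  rw [ER, e0Z, coeff_zero_prod]
  refine prod_congr rfl fun s _ => ?_
  rw [coeff_zero_eq_eval_zero, eval_pow, eval_add, eval_X, eval_C, zero_add]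

/-- `e₀(q₀) ≠ 0`. -/
theorem e0Z_ne_zero (n q₀ : ℕ) : e0Z n q₀ ≠ 0 := by
  rw [e0Z]
  refine prod_ne_zero_iff.2 fun s hs => pow_ne_zero _ ?_
  have : s ≠ q₀ := (mem_erase.1 hs).1
  omega

/-- No prime `p > n` divides `e₀(q₀)` (all factors are `s − q₀` with `0 < |s − q₀| ≤ n`). -/
theorem not_dvd_e0Z {p : ℕ} (hp : p.Prime) {n : ℕ} (hn : n < p) (q₀ : ℕ) (hq₀ : q₀ ≤ n) :
    ¬ (p : ℤ) ∣ e0Z n q₀ := by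
  have hpZ : Prime (p : ℤ) := Nat.prime_iff_prime_int.1 hp
  rw [e0Z]
  intro h
  obtain ⟨s, hs, hdvd⟩ := (hpZ.dvd_finsetProd_iff _).1 h
  have hsq : s ≠ q₀ ∧ s < n + 1 := by simpa [mem_erase, mem_range] using hs
  have h1 : (p : ℤ) ∣ (s : ℤ) - q₀ := hpZ.dvd_of_dvd_pow hdvd
  have h2 : ((s : ℤ) - q₀) = 0 := by
    refine Int.eq_zero_of_dvd_of_natAbs_lt_natAbs h1 ?_
    simp only [Int.natAbs_natCast]
    omega
  omega

/-! ### Block form of the numerator -/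

/-- The two Pochhammer factors attached to one lower parameter are the product over the COMPLEMENT of its block:
`(X)_β (X + n + 1 − β)_β = ∏_{s ∈ [0,n] ∖ [β, n−β]} (X + s)` (`2β ≤ n + 1`). -/
theorem pochPoly_pair_eq_prod_compl (n β : ℕ) (hβ : 2 * β ≤ n + 1) :
    pochPoly 0 β * pochPoly ((n + 1 - β : ℕ) : ℚ) β =
      ∏ s ∈ range (n + 1) \ block n β, (X + C (s : ℚ)) := by
  have hsplit : range (n + 1) \ block n β = range β ∪ Ico (n + 1 - β) (n + 1) := by
    ext s
    simp only [block, mem_sdiff, mem_range, mem_Icc, mem_union, mem_Ico]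
    omega
  have hdisj : Disjoint (range β) (Ico (n + 1 - β) (n + 1)) := by
    rw [Finset.disjoint_left]
    intro s hs hs'
    rw [mem_range] at hs
    rw [mem_Ico] at hs'
    omega
  rw [hsplit, prod_union hdisj, prod_Ico_eq_prod_range, show n + 1 - (n + 1 - β) = β by omega]
  unfold pochPoly
  congr 1
  · refine prod_congr rfl fun s _ => ?_
    rw [zero_add]
  · refine prod_congr rfl fun s _ => ?_
    push_cast
    rfl

/-- `numPoly b` is the ℚ-image of the integer block-form numerator. -/
theorem numPoly_eq_numR (b : ℕ → ℤ) (hb : InBox b) (hhalf : ∀ j ∈ range 7, 2 * b (j + 1) ≤ b 0 + 1) :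
    numPoly b = numR ℚ (b 0).toNat (fun j => (b (j + 1)).toNat) := by
  obtain ⟨h0, hj⟩ := hb
  have hb0 : (b 0 : ℚ) = ((b 0).toNat : ℚ) := by exact_mod_cast (Int.toNat_of_nonneg h0).symm
  unfold numPoly numR
  rw [hb0]
  congr 1
  refine prod_congr rfl fun j hj' => ?_
  have hβ0 := (hj j hj').1
  have hβ1 := (hj j hj').2
  have hh := hhalf j hj'
  have hcast : ((b 0 - b (j + 1) + 1 : ℤ) : ℚ) = (((b 0).toNat + 1 - (b (j + 1)).toNat : ℕ) : ℚ) := by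
    have e1 : (b 0 : ℤ) = ((b 0).toNat : ℤ) := (Int.toNat_of_nonneg h0).symm
    have e2 : (b (j + 1) : ℤ) = ((b (j + 1)).toNat : ℤ) := (Int.toNat_of_nonneg hβ0).symm
    have hle : (b (j + 1)).toNat ≤ (b 0).toNat + 1 := by omega
    have e2' : (b (j + 1) : ℚ) = ((b (j + 1)).toNat : ℚ) := by exact_mod_cast e2
    rw [Nat.cast_sub hle]
    push_cast
    rw [hb0, e2']
    ring
  rw [hcast]
  exact pochPoly_pair_eq_prod_compl _ _ (by omega)

/-! ### From partial-fraction data to a polynomial identity -/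

/-- The partial-fraction expansion with cleared denominators, as a polynomial in `y = t + 1`:
`L = Σ_{q ≤ n} Σ_{o<6} c_{o,q} (X + q)^{5−o} ∏_{s ≠ q} (X + s)^6`. -/
def Lpoly (n : ℕ) (c : ℕ → ℕ → ℚ) : ℚ[X] :=
  ∑ q ∈ range (n + 1), ∑ o ∈ range 6,
    C (c o q) * (X + C (q : ℚ)) ^ (5 - o) * ∏ s ∈ (range (n + 1)).erase q, (X + C (s : ℚ)) ^ 6

/-- Evaluation of `L` away from the poles: `L(y) = (∏_{s ≤ n} (y+s))^6 · Σ_{q,o} c_{o,q}/(y+q)^{o+1}`. -/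
theorem Lpoly_eval (n : ℕ) (c : ℕ → ℕ → ℚ) (y : ℚ) (hy : ∀ s ∈ range (n + 1), y + s ≠ 0) :
    (Lpoly n c).eval y =
      (∏ s ∈ range (n + 1), (y + s)) ^ 6 *
        ∑ q ∈ range (n + 1), ∑ o ∈ range 6, c o q / (y + q) ^ (o + 1) := by
  rw [Lpoly, eval_finsetSum, mul_sum]
  refine sum_congr rfl fun q hq => ?_
  rw [eval_finsetSum, mul_sum]
  refine sum_congr rfl fun o ho => ?_
  have hyq : y + q ≠ 0 := hy q hq
  have hprod : (∏ s ∈ range (n + 1), (y + s)) ^ 6 =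
      (y + q) ^ (5 - o) * (y + q) ^ (o + 1) * ∏ s ∈ (range (n + 1)).erase q, (y + (s : ℚ)) ^ 6 := by
    rw [← mul_prod_erase (range (n + 1)) (fun s => y + (s : ℚ)) hq, mul_pow, ← prod_pow, ← pow_add]
    congr 2
    have := mem_range.1 ho
    omega
  simp only [eval_mul, eval_C, eval_pow, eval_add, eval_X, eval_prod]
  rw [hprod]
  field_simp

/-- **Polynomial identity.** Partial-fraction data of `R_b` satisfy `L = numPoly b` in `ℚ[X]`. -/
theorem Lpoly_eq_numPoly (b : ℕ → ℤ) {c : ℕ → ℕ → ℚ} (hc : IsPFData b c) :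
    Lpoly (b 0).toNat c = numPoly b := by
  set n := (b 0).toNat with hn
  apply Polynomial.eq_of_infinite_eval_eq
  have hsub : (fun m : ℕ => ((m : ℚ) + 1)) '' Set.univ ⊆
      {x : ℚ | (Lpoly n c).eval x = (numPoly b).eval x} := by
    rintro x ⟨m, -, rfl⟩
    have hpole : ∀ q, q ≤ n → (m : ℚ) + q + 1 ≠ 0 := fun q _ => by positivity
    have h := hc (m : ℚ) hpole
    have hy : ∀ s ∈ range (n + 1), (m : ℚ) + 1 + s ≠ 0 := fun s _ => by positivity
    have hD : (∏ s ∈ range (n + 1), ((m : ℚ) + 1 + s)) ≠ 0 := prod_ne_zero_iff.2 hy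
    show (Lpoly n c).eval ((m : ℚ) + 1) = (numPoly b).eval ((m : ℚ) + 1)
    rw [Lpoly_eval n c _ hy]
    have hnum : ((numPoly b).comp (X + C 1)).eval (m : ℚ) = (numPoly b).eval ((m : ℚ) + 1) := by
      rw [eval_comp, eval_add, eval_X, eval_C]
    have hpoch : poch ((m : ℚ) + 1) (n + 1) = ∏ s ∈ range (n + 1), ((m : ℚ) + 1 + s) := rfl
    rw [pfEval, hnum, hpoch] at h
    have h' : ∑ q ∈ range (n + 1), ∑ o ∈ range 6, c o q / ((m : ℚ) + 1 + q) ^ (o + 1) =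
        (numPoly b).eval ((m : ℚ) + 1) / (∏ s ∈ range (n + 1), ((m : ℚ) + 1 + s)) ^ 6 := by
      rw [← h]
      refine sum_congr rfl fun q _ => sum_congr rfl fun o _ => ?_
      ring
    rw [h', mul_div_cancel₀ _ (pow_ne_zero 6 hD)]
  refine Set.Infinite.mono hsub (Set.infinite_univ.image fun x _ y _ hxy => ?_)
  exact_mod_cast (add_left_inj (1 : ℚ)).1 hxy

/-! ### Taylor expansion at a pole -/

/-- At the pole `y = −q₀`: `numPoly(X − q₀) ≡ (Σ_{o<6} c_{o,q₀} X^{5−o}) · E_{q₀} (mod X^6)`. -/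
theorem taylor_numPoly_congr (b : ℕ → ℤ) {c : ℕ → ℕ → ℚ} (hc : IsPFData b c) {q₀ : ℕ}
    (hq₀ : q₀ ≤ (b 0).toNat) :
    X ^ 6 ∣ taylor (-(q₀ : ℚ)) (numPoly b) -
      (∑ o ∈ range 6, C (c o q₀) * X ^ (5 - o)) * ER ℚ (b 0).toNat q₀ := by
  set n := (b 0).toNat with hn
  have hmem : q₀ ∈ range (n + 1) := mem_range.2 (by omega)
  rw [← Lpoly_eq_numPoly b hc, Lpoly, map_sum, ← add_sum_erase _ _ hmem]
  -- the `q = q₀` term is exactly the subtracted expression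
  have hmain : taylor (-(q₀ : ℚ)) (∑ o ∈ range 6, C (c o q₀) * (X + C (q₀ : ℚ)) ^ (5 - o) *
        ∏ s ∈ (range (n + 1)).erase q₀, (X + C (s : ℚ)) ^ 6) =
      (∑ o ∈ range 6, C (c o q₀) * X ^ (5 - o)) * ER ℚ n q₀ := by
    rw [map_sum, sum_mul]
    refine sum_congr rfl fun o _ => ?_
    rw [taylor_mul, taylor_mul, taylor_pow, taylor_C, taylor_X_add_C, add_neg_cancel, C_0, add_zero,
      taylor_prod']
    congr 1
    rw [ER]
    refine prod_congr rfl fun s _ => ?_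
    rw [taylor_pow, taylor_X_add_C, sub_eq_add_neg]
  rw [hmain, add_sub_cancel_left]
  refine dvd_sum fun q hq => ?_
  have hq' : q ≠ q₀ := (mem_erase.1 hq).1
  rw [map_sum]
  refine dvd_sum fun o _ => ?_
  rw [taylor_mul, taylor_prod']
  refine Dvd.dvd.mul_left ?_ _
  have hmem' : q₀ ∈ (range (n + 1)).erase q := mem_erase.2 ⟨fun h => hq' h.symm, hmem⟩
  have hfac : taylor (-(q₀ : ℚ)) ((X + C (q₀ : ℚ)) ^ 6) = X ^ 6 := by
    rw [taylor_pow, taylor_X_add_C, add_neg_cancel, C_0, add_zero]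
  rw [← hfac]
  exact Finset.dvd_prod_of_mem (fun s : ℕ => taylor (-(q₀ : ℚ)) ((X + C (s : ℚ)) ^ 6)) hmem'

/-- **The partial-fraction coefficients are Taylor coefficients with integer numerators**:
`e₀(q₀)^6 · c_{o,q₀} = z_{q₀, 5−o}` for `q₀ ≤ n`, `o < 6`. -/
theorem pf_coeff_eq (b : ℕ → ℤ) (hb : InBox b) (hhalf : ∀ j ∈ range 7, 2 * b (j + 1) ≤ b 0 + 1)
    {c : ℕ → ℕ → ℚ} (hc : IsPFData b c) {q₀ : ℕ} (hq₀ : q₀ ≤ (b 0).toNat) {o : ℕ} (ho : o < 6) :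
    ((e0Z (b 0).toNat q₀ : ℤ) : ℚ) ^ 6 * c o q₀ =
      (zZ (b 0).toNat (fun j => (b (j + 1)).toNat) q₀ (5 - o) : ℚ) := by
  set n := (b 0).toNat with hn
  set β : ℕ → ℕ := fun j => (b (j + 1)).toNat with hβ
  set S : ℚ[X] := ∑ o ∈ range 6, C (c o q₀) * X ^ (5 - o) with hS
  set J : ℚ[X] := truncInv (ER ℚ n q₀) 6 with hJ
  have h1 := taylor_numPoly_congr b hc hq₀
  have h2 := truncInv_spec (ER ℚ n q₀) 6
  have he0 : (ER ℚ n q₀).coeff 0 = (e0Z n q₀ : ℚ) := by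
    rw [← ER_map (Int.castRingHom ℚ), coeff_map, ER_coeff_zero]; simp
  -- X^6 ∣ taylor(numPoly)·J − S·C(e₀^6)
  have h3 : X ^ 6 ∣ taylor (-(q₀ : ℚ)) (numPoly b) * J - S * C ((e0Z n q₀ : ℚ) ^ 6) := by
    have h1' := h1.mul_right J
    have h2' := h2.mul_left S
    rw [he0] at h2'
    have : taylor (-(q₀ : ℚ)) (numPoly b) * J - S * C ((e0Z n q₀ : ℚ) ^ 6) =
        (taylor (-(q₀ : ℚ)) (numPoly b) - S * ER ℚ n q₀) * J + S * (ER ℚ n q₀ * J - C ((e0Z n q₀ : ℚ) ^ 6)) := by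
      ring
    rw [this]
    exact dvd_add h1' h2'
  have h4 := coeff_eq_of_X_pow_dvd_sub h3 (show 5 - o < 6 by omega)
  -- left side: the integer polynomial
  have hL : taylor (-(q₀ : ℚ)) (numPoly b) * J =
      (taylor (-(q₀ : ℤ)) (numR ℤ n β) * truncInv (ER ℤ n q₀) 6).map (Int.castRingHom ℚ) := by
    rw [Polynomial.map_mul, map_taylor, numR_map, truncInv_map, ER_map, numPoly_eq_numR b hb hhalf]
    simp [hJ, hn, hβ]
  -- right side: the single surviving coefficient
  have hR : (S * C ((e0Z n q₀ : ℚ) ^ 6)).coeff (5 - o) = ((e0Z n q₀ : ℤ) : ℚ) ^ 6 * c o q₀ := by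
    rw [hS, sum_mul, finsetSum_coeff, sum_eq_single o]
    · simp only [coeff_mul_C, coeff_C_mul, coeff_X_pow, if_true]; ring
    · intro o' ho' hne
      have hne' : 5 - o ≠ 5 - o' := by have := mem_range.1 ho'; omega
      simp only [coeff_mul_C, coeff_C_mul, coeff_X_pow, if_neg hne']; ring
    · intro h; exact absurd (mem_range.2 ho) h
  rw [hL, coeff_map, hR] at h4
  rw [← h4, zZ]
  simp

end Summit.KontsevichZagierPeriods.Zeta5Search.BigPrime

end
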